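import Literature.NumberTheory.Automorphic.FundamentalDomainUnfolding
import HarnessLib

/-!
# Coset unfolding: the integral over ANY fundamental domain of a finite-index `Γ' ≤ SL₂(ℤ)` as an
# integral of the coset trace over `𝒟`; transport of fundamental domains under `GL₂⁺(ℝ)`

Topic `NumberTheory/Automorphic`; namespace `Literature.NumberTheory.Automorphic`. Theorems only
(one auxiliary `Equiv`), on top of `FundamentalDomainUnfolding` (`IsHypFundamentalDomain Γ F`,
the unfolding `Σ_{γ ∈ Γ} ∫_F φ(γ w) dμ(w) = 2∫_ℍ φ`, `ae_tsum_indicator_inv_smul`). Two general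
measure-theoretic facts about fundamental domains in `ℍ` (Iwaniec, *Spectral Methods*, §2.2–2.4;
Diamond–Shurman §5.4: "the integral over `X(Γ)` as a sum over coset representatives"), in the
generality needed to move Rankin–Selberg integrals of `Γ₀(N)` to the modular surface after a scaling
`z ↦ z/t` (the Rankin–Selberg integral of `|f|²y²` against `E(tz, s)`, `t ∣ N`):

* `IsHypFundamentalDomain.conjAct_inv_smul` — **transport**: if `F` is a fundamental domain of
  `Γ ≤ GL₂(ℝ)` then `g⁻¹ • F` is one of `g⁻¹ Γ g` (`= toConjAct g⁻¹ • Γ`), for any `g ∈ GL₂(ℝ)`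
  (orbits and the null exceptional set are transported by the measure-preserving `z ↦ g z`);
* `setLIntegral_eq_setLIntegral_fd_sum_cosets` — **coset unfolding**: for `Γ' ≤ SL₂(ℤ)` of finite
  index with `-1 ∈ Γ'`, ANY fundamental domain `F₁` of its image `Γ'' ≤ GL₂(ℝ)`, and a measurable
  `Γ'`-invariant `ψ ≥ 0`:
  **`∫⁻_{F₁} ψ dμ = ∫⁻_𝒟 Σ_{q ∈ SL₂(ℤ)/Γ'} ψ((out q)⁻¹ w) dμ(w)`**.
  Proof: unfold `φ = 𝟙_{F₁} ψ` over the modular group and `𝒟` (`tsum_setLIntegral_smul_eq`: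
  `Σ_{g ∈ SL₂(ℤ)} ∫_𝒟 φ(g⁻¹w) = 2∫_{F₁} ψ`), regroup `SL₂(ℤ) = ⊔_q (out q)Γ'`, `g = (out q)δ`,
  `φ(g⁻¹ w) = 𝟙_{F₁}(δ⁻¹ v) ψ(v)`, `v = (out q)⁻¹ w` (`ψ` is `Γ'`-invariant), and
  `Σ_{δ ∈ Γ'} 𝟙_{F₁}(δ⁻¹ v) = 2` for a.e. `v` (`ae_tsum_indicator_inv_smul` for `(Γ'', F₁)`,
  transported along `w ↦ (out q)⁻¹ w`).

## References

* H. Iwaniec, *Spectral Methods of Automorphic Forms*, 2nd ed., GSM 53, AMS 2002, §2.2–2.4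
  (fundamental domains; Prop. 2.4, the domain of a finite-index subgroup), PDF pp. 28–31.
  [cite: Iwaniec2002, §2.4 Prop. 2.4]
* F. Diamond, J. Shurman, GTM 228, §5.4 (integrals over `X(Γ)` via coset representatives).

## Mathlib / tree search

Tree: `IsHypFundamentalDomain`, `tsum_setLIntegral_smul_eq`, `ae_tsum_indicator_inv_smul`,
`setLIntegral_smul_eq`, `isHypFundamentalDomain_modular_fd`, `modular_le_range_toGL`,
`neg_one_mem_modular`, `isDiscreteSubgroup_modular` (`FundamentalDomainUnfolding`,
`HyperbolicLaplaceSpectrum`); `isHypFundamentalDomain_gamma0Domain`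
(`Sieve/QuadraticRootsPrimeModuliDFIGamma0Domain`, the union of translates for `Γ₀(q)`; not needed
here). Mathlib: `ConjAct`, `Subgroup.mem_pointwise_smul_iff_inv_smul_mem`, `Set.mem_inv_smul_set_iff`,
`MeasureTheory.measure_preimage_smul`, `ENNReal.tsum_prod'`, `Equiv.tsum_eq`, `QuotientGroup.eq`.
-/

noncomputable section

open MeasureTheory Set Filter UpperHalfPlane Matrix ConjAct
open scoped ENNReal MatrixGroups Pointwise Topology

namespace Literature.NumberTheory.Automorphic

/-! ### 1. Transport of fundamental domains under conjugation -/

section Transport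

variable {Γ : Subgroup (GL (Fin 2) ℝ)} {F : Set ℍ}

/-- Membership in the conjugate `g⁻¹ Γ g = toConjAct g⁻¹ • Γ`: `x ∈ g⁻¹Γg ↔ g x g⁻¹ ∈ Γ`. [folklore] -/
theorem mem_conjAct_inv_smul_iff {g x : GL (Fin 2) ℝ} :
    x ∈ toConjAct g⁻¹ • Γ ↔ g * x * g⁻¹ ∈ Γ := by
  rw [Subgroup.mem_pointwise_smul_iff_inv_smul_mem, ← toConjAct_inv, inv_inv, toConjAct_smul]

/-- **Transport of a fundamental domain**: if `F` is a fundamental domain of `Γ` then `g⁻¹ • F`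
is a fundamental domain of `g⁻¹ Γ g`, for every `g ∈ GL₂(ℝ)`. [cite: Iwaniec2002, §2.2, PDF pp. 28–29] -/
theorem IsHypFundamentalDomain.conjAct_inv_smul (hF : IsHypFundamentalDomain Γ F) (g : GL (Fin 2) ℝ) :
    IsHypFundamentalDomain (toConjAct g⁻¹ • Γ) (g⁻¹ • F) := by
  have hset : g⁻¹ • F = (fun z : ℍ => g • z) ⁻¹' F := by
    ext z; rw [Set.mem_inv_smul_set_iff, Set.mem_preimage]
  refine ⟨?_, fun z => ?_, ?_⟩
  · rw [hset]; exact hF.measurableSet.preimage (measurable_const_smul g)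
  · obtain ⟨γ, hγ, hγF⟩ := hF.covers (g • z)
    refine ⟨g⁻¹ * γ * g, ?_, ?_⟩
    · rw [mem_conjAct_inv_smul_iff]
      simpa [mul_assoc] using hγ
    · rw [Set.mem_inv_smul_set_iff, ← mul_smul, show g * (g⁻¹ * γ * g) = γ * g by group, mul_smul]
      exact hγF
  · -- a.e. uniqueness, transported from `F` along `z ↦ g z`
    have hbad := hF.ae_unique
    rw [ae_iff] at hbad ⊢
    refine measure_mono_null (fun z hz => ?_) (by
      rw [MeasureTheory.measure_preimage_smul (μ := (volume : Measure ℍ)) g]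
      exact hbad)
    simp only [Set.mem_setOf_eq, not_forall, exists_prop, Set.mem_preimage] at hz ⊢
    obtain ⟨hzF, δ, hδ, hδF, hne⟩ := hz
    rw [Set.mem_inv_smul_set_iff] at hzF hδF
    refine ⟨hzF, g * δ * g⁻¹, mem_conjAct_inv_smul_iff.mp hδ, ?_, ?_⟩
    · rw [mul_smul, mul_smul, inv_smul_smul]; exact hδF
    · rw [mul_smul, mul_smul, inv_smul_smul]
      exact fun h => hne (smul_left_cancel g h)

end Transport

/-! ### 2. Regrouping a sum over `SL₂(ℤ)` by the cosets of a subgroup -/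

section Cosets

variable (Γ' : Subgroup SL(2, ℤ))

/-- `SL₂(ℤ) = ⊔_q (out q) Γ'`: the bijection `(q, δ) ↦ (out q) δ`. [folklore] -/
def cosetProdEquiv : (SL(2, ℤ) ⧸ Γ') × Γ' ≃ SL(2, ℤ) where
  toFun p := Quotient.out p.1 * p.2
  invFun g := ⟨QuotientGroup.mk g,
    ⟨(Quotient.out (QuotientGroup.mk g : SL(2, ℤ) ⧸ Γ'))⁻¹ * g,
      QuotientGroup.eq.mp (QuotientGroup.out_eq' (QuotientGroup.mk g : SL(2, ℤ) ⧸ Γ'))⟩⟩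
  left_inv p := by
    obtain ⟨q, δ⟩ := p
    have hq : (QuotientGroup.mk (Quotient.out q * (δ : SL(2, ℤ))) : SL(2, ℤ) ⧸ Γ') = q := by
      rw [QuotientGroup.mk_mul_of_mem _ δ.2, QuotientGroup.out_eq']
    ext1
    · exact hq
    · apply Subtype.ext
      simp only [hq, inv_mul_cancel_left]
  right_inv g := by
    simp only [mul_inv_cancel_left]

variable {Γ'}

/-- Regrouping an unconditional sum over `SL₂(ℤ)` by the left cosets of `Γ'`:
`Σ_{g} a(g) = Σ_q Σ_{δ ∈ Γ'} a((out q) δ)` (in `ℝ≥0∞`). [folklore] -/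
theorem tsum_sl2z_eq_tsum_cosets (a : SL(2, ℤ) → ℝ≥0∞) :
    ∑' g : SL(2, ℤ), a g = ∑' q : SL(2, ℤ) ⧸ Γ', ∑' δ : Γ', a (Quotient.out q * δ) := by
  rw [← Equiv.tsum_eq (cosetProdEquiv Γ'), ENNReal.tsum_prod']
  rfl

end Cosets

/-! ### 3. Coset unfolding -/

section CosetUnfolding

variable {Γ' : Subgroup SL(2, ℤ)}

/-- The image `Γ'' ≤ GL₂(ℝ)` of `Γ' ≤ SL₂(ℤ)` lies in the modular group `𝒮ℒ`. [folklore] -/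
theorem map_le_modular : Γ'.map (Matrix.SpecialLinearGroup.mapGL ℝ) ≤ (𝒮ℒ : Subgroup (GL (Fin 2) ℝ)) := by
  rintro _ ⟨g, _, rfl⟩
  exact ⟨g, rfl⟩

/-- `Γ''` lies in the image of `SL₂(ℝ)`. [folklore] -/
theorem map_le_range_toGL :
    Γ'.map (Matrix.SpecialLinearGroup.mapGL ℝ) ≤
      (Matrix.SpecialLinearGroup.toGL : SL(2, ℝ) →* GL (Fin 2) ℝ).range :=
  map_le_modular.trans modular_le_range_toGL

/-- `Γ''` is countable. [folklore] -/
theorem countable_map : (Γ'.map (Matrix.SpecialLinearGroup.mapGL ℝ) : Set (GL (Fin 2) ℝ)).Countable :=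
  isDiscreteSubgroup_modular.countable.mono map_le_modular

/-- `-1 ∈ Γ''` when `-1 ∈ Γ'`. [folklore] -/
theorem neg_one_mem_map (hneg : (-1 : SL(2, ℤ)) ∈ Γ') :
    (-1 : GL (Fin 2) ℝ) ∈ Γ'.map (Matrix.SpecialLinearGroup.mapGL ℝ) := by
  refine ⟨-1, hneg, ?_⟩
  ext i j
  fin_cases i <;> fin_cases j <;> simp [Matrix.SpecialLinearGroup.mapGL, Matrix.SpecialLinearGroup.toGL]

/-- `SL₂(ℤ) → GL₂(ℝ)` is injective. [folklore] -/
theorem mapGL_real_injective :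
    Function.Injective (Matrix.SpecialLinearGroup.mapGL ℝ : SL(2, ℤ) → GL (Fin 2) ℝ) := by
  intro g g' h
  ext i j
  have := congrArg (fun m : GL (Fin 2) ℝ => (m : Matrix (Fin 2) (Fin 2) ℝ) i j) h
  simpa [Matrix.SpecialLinearGroup.mapGL, Matrix.SpecialLinearGroup.toGL] using this

/-- **For a.e. `v`: `Σ_{δ ∈ Γ'} 𝟙_{F₁}(δ⁻¹ v) = 2`** for a fundamental domain `F₁` of `Γ''` (the sum
over `Γ'` itself rather than its image). [folklore] -/
theorem ae_tsum_indicator_inv_sl_smul (hneg : (-1 : SL(2, ℤ)) ∈ Γ') {F₁ : Set ℍ}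
    (hF₁ : IsHypFundamentalDomain (Γ'.map (Matrix.SpecialLinearGroup.mapGL ℝ)) F₁) :
    ∀ᵐ v : ℍ, (∑' δ : Γ', F₁.indicator (fun _ => (1 : ℝ≥0∞)) ((δ : SL(2, ℤ))⁻¹ • v)) = 2 := by
  have h := ae_tsum_indicator_inv_smul map_le_range_toGL (neg_one_mem_map hneg) countable_map hF₁ (1 : ℝ≥0∞)
  filter_upwards [h] with v hv
  rw [one_add_one_eq_two] at hv
  rw [← hv]
  -- reindex `Γ' ≃ Γ''`
  let e := Γ'.equivMapOfInjective (Matrix.SpecialLinearGroup.mapGL ℝ) mapGL_real_injective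
  rw [← Equiv.tsum_eq e.toEquiv]
  refine tsum_congr fun δ => ?_
  have he : ((e δ : Γ'.map (Matrix.SpecialLinearGroup.mapGL ℝ)) : GL (Fin 2) ℝ) =
      Matrix.SpecialLinearGroup.mapGL ℝ (δ : SL(2, ℤ)) :=
    Subgroup.coe_equivMapOfInjective_apply Γ' _ mapGL_real_injective δ
  show F₁.indicator (fun _ => (1 : ℝ≥0∞)) ((δ : SL(2, ℤ))⁻¹ • v) =
    F₁.indicator (fun _ => (1 : ℝ≥0∞)) (((e.toEquiv δ : Γ'.map (Matrix.SpecialLinearGroup.mapGL ℝ)) : GL (Fin 2) ℝ)⁻¹ • v)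
  rw [MulEquiv.toEquiv_eq_coe, MulEquiv.coe_toEquiv, he, ← map_inv]
  rfl

/-- **Coset unfolding.** Let `Γ' ≤ SL₂(ℤ)` have finite index (a `Fintype` structure on `SL₂(ℤ)/Γ'`)
and contain `-1`, let `F₁` be ANY
fundamental domain of its image `Γ'' ≤ GL₂(ℝ)`, and `ψ ≥ 0` measurable and `Γ'`-invariant. Then
`∫⁻_{F₁} ψ dμ = ∫⁻_𝒟 Σ_{q ∈ SL₂(ℤ)/Γ'} ψ((out q)⁻¹ w) dμ(w)` — the integral over `Γ'∖ℍ` computed on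
the modular surface through the coset trace (Iwaniec Prop. 2.4; Diamond–Shurman §5.4), for an
arbitrary fundamental domain on the left. [cite: Iwaniec2002, §2.4 Prop. 2.4] -/
theorem setLIntegral_eq_setLIntegral_fd_sum_cosets [Fintype (SL(2, ℤ) ⧸ Γ')]
    (hneg : (-1 : SL(2, ℤ)) ∈ Γ') {F₁ : Set ℍ}
    (hF₁ : IsHypFundamentalDomain (Γ'.map (Matrix.SpecialLinearGroup.mapGL ℝ)) F₁)
    {ψ : ℍ → ℝ≥0∞} (hψm : Measurable ψ) (hψ : ∀ γ ∈ Γ', ∀ w : ℍ, ψ (γ • w) = ψ w) :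
    ∫⁻ w in F₁, ψ w = ∫⁻ w in ModularGroup.fd, ∑ q : SL(2, ℤ) ⧸ Γ', ψ ((Quotient.out q)⁻¹ • w) := by
  classical
  haveI : Countable SL(2, ℤ) := by
    have : Countable (Matrix (Fin 2) (Fin 2) ℤ) := by unfold Matrix; infer_instance
    exact Subtype.countable
  haveI : Countable Γ' := Subtype.countable
  -- the test function `φ = 𝟙_{F₁} ψ`
  set φ : ℍ → ℝ≥0∞ := fun w => F₁.indicator (fun _ => (1 : ℝ≥0∞)) w * ψ w with hφ
  have hφm : Measurable φ := ((measurable_const.indicator hF₁.measurableSet).mul hψm)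
  have hφint : ∫⁻ w, φ w = ∫⁻ w in F₁, ψ w := by
    rw [← lintegral_indicator hF₁.measurableSet]
    refine lintegral_congr fun w => ?_
    by_cases hw : w ∈ F₁
    · simp [hφ, Set.indicator_of_mem hw]
    · simp [hφ, Set.indicator_of_notMem hw]
  -- modular unfolding: `Σ_{γ ∈ 𝒮ℒ} ∫_𝒟 φ(γ w) = 2 ∫_{F₁} ψ`
  have hunf := tsum_setLIntegral_smul_eq modular_le_range_toGL neg_one_mem_modular
    isDiscreteSubgroup_modular.countable isHypFundamentalDomain_modular_fd hφm.aemeasurable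
  rw [hφint] at hunf
  -- reindex the sum by `SL₂(ℤ)` and by `g ↦ g⁻¹`
  let e₁ : SL(2, ℤ) ≃ (𝒮ℒ : Subgroup (GL (Fin 2) ℝ)) :=
    (MonoidHom.ofInjective mapGL_real_injective).toEquiv
  have he₁ : ∀ g : SL(2, ℤ), ((e₁ g : (𝒮ℒ : Subgroup (GL (Fin 2) ℝ))) : GL (Fin 2) ℝ) =
      Matrix.SpecialLinearGroup.mapGL ℝ g := fun g => rfl
  have hre : ∑' γ : (𝒮ℒ : Subgroup (GL (Fin 2) ℝ)), ∫⁻ w in ModularGroup.fd, φ ((γ : GL (Fin 2) ℝ) • w) =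
      ∑' g : SL(2, ℤ), ∫⁻ w in ModularGroup.fd, φ (g⁻¹ • w) := by
    rw [← Equiv.tsum_eq e₁, ← Equiv.tsum_eq (Equiv.inv SL(2, ℤ))]
    refine tsum_congr fun g => ?_
    simp only [Equiv.inv_apply, he₁]
    rfl
  rw [hre, tsum_sl2z_eq_tsum_cosets (Γ' := Γ')] at hunf
  -- the inner sum over `δ ∈ Γ'`, for each coset `q`
  have hinner : ∀ q : SL(2, ℤ) ⧸ Γ',
      ∑' δ : Γ', ∫⁻ w in ModularGroup.fd, φ ((Quotient.out q * (δ : SL(2, ℤ)))⁻¹ • w) =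
        2 * ∫⁻ w in ModularGroup.fd, ψ ((Quotient.out q)⁻¹ • w) := by
    intro q
    set A : SL(2, ℤ) := Quotient.out q with hA
    -- `φ((Aδ)⁻¹ w) = 𝟙_{F₁}(δ⁻¹ (A⁻¹ w)) ψ(A⁻¹ w)`
    have hterm : ∀ (δ : Γ') (w : ℍ), φ ((A * (δ : SL(2, ℤ)))⁻¹ • w) =
        F₁.indicator (fun _ => (1 : ℝ≥0∞)) ((δ : SL(2, ℤ))⁻¹ • A⁻¹ • w) * ψ (A⁻¹ • w) := by
      intro δ w
      simp only [hφ]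
      rw [_root_.mul_inv_rev, mul_smul, hψ _ (Γ'.inv_mem δ.2)]
    simp_rw [hterm]
    have hmeasA : Measurable fun w : ℍ => A⁻¹ • w := by
      have e : (fun w : ℍ => A⁻¹ • w) = fun w => (Matrix.SpecialLinearGroup.mapGL ℝ A⁻¹ : GL (Fin 2) ℝ) • w :=
        rfl
      rw [e]; exact measurable_const_smul _
    have hmeas : ∀ δ : Γ', AEMeasurable
        (fun w : ℍ => F₁.indicator (fun _ => (1 : ℝ≥0∞)) ((δ : SL(2, ℤ))⁻¹ • A⁻¹ • w) * ψ (A⁻¹ • w))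
        (volume.restrict ModularGroup.fd) := by
      intro δ
      refine (Measurable.mul ?_ (hψm.comp hmeasA)).aemeasurable
      have e : (fun w : ℍ => F₁.indicator (fun _ => (1 : ℝ≥0∞)) ((δ : SL(2, ℤ))⁻¹ • A⁻¹ • w)) =
          (fun v : ℍ => F₁.indicator (fun _ => (1 : ℝ≥0∞)) v) ∘
            fun w : ℍ => (Matrix.SpecialLinearGroup.mapGL ℝ ((δ : SL(2, ℤ))⁻¹ * A⁻¹) : GL (Fin 2) ℝ) • w := by
        funext w; simp only [Function.comp_apply, map_mul, mul_smul]; rfl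
      rw [e]
      exact (measurable_const.indicator hF₁.measurableSet).comp (measurable_const_smul _)
    rw [← lintegral_tsum hmeas]
    simp_rw [ENNReal.tsum_mul_right]
    -- a.e. `Σ_δ 𝟙_{F₁}(δ⁻¹ A⁻¹ w) = 2`, transported along `w ↦ A⁻¹ w`
    have hae := ae_tsum_indicator_inv_sl_smul hneg hF₁
    have haeA : ∀ᵐ w : ℍ, (∑' δ : Γ', F₁.indicator (fun _ => (1 : ℝ≥0∞)) ((δ : SL(2, ℤ))⁻¹ • A⁻¹ • w)) = 2 := by
      rw [ae_iff] at hae ⊢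
      have hsub : {w : ℍ | ¬ (∑' δ : Γ', F₁.indicator (fun _ => (1 : ℝ≥0∞)) ((δ : SL(2, ℤ))⁻¹ • A⁻¹ • w)) = 2} ⊆
          (fun w : ℍ => (Matrix.SpecialLinearGroup.mapGL ℝ A⁻¹ : GL (Fin 2) ℝ) • w) ⁻¹'
            {v : ℍ | ¬ (∑' δ : Γ', F₁.indicator (fun _ => (1 : ℝ≥0∞)) ((δ : SL(2, ℤ))⁻¹ • v)) = 2} :=
        fun w hw => hw
      refine measure_mono_null hsub ?_
      rw [MeasureTheory.measure_preimage_smul]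
      exact hae
    rw [← lintegral_const_mul' 2 _ (by norm_num)]
    refine lintegral_congr_ae ((ae_restrict_of_ae haeA).mono fun w hw => ?_)
    beta_reduce
    rw [hw]
  simp_rw [hinner] at hunf
  rw [tsum_fintype, ← Finset.mul_sum, ← lintegral_finsetSum' _ (fun q _ => ?_)] at hunf
  · exact ((ENNReal.mul_right_inj two_ne_zero ENNReal.ofNat_ne_top).mp hunf).symm
  · have e : (fun w : ℍ => ψ ((Quotient.out q)⁻¹ • w)) =
        ψ ∘ fun w => (Matrix.SpecialLinearGroup.mapGL ℝ (Quotient.out q)⁻¹ : GL (Fin 2) ℝ) • w := rfl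
    rw [e]
    exact (hψm.comp (measurable_const_smul _)).aemeasurable

end CosetUnfolding

end Literature.NumberTheory.Automorphic

end
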